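import Mathlib
import Literature.NumberTheory.LFunctions.FeketePolynomial
import Literature.RingTheory.Valuation.AlgClosedResidue
import Literature.RingTheory.Valuation.RootReduction
import Summits.ValiantsHypothesis.ValiantsHypothesis.Theses.FeketeSOS
import Summits.ValiantsHypothesis.ValiantsHypothesis.Theorems.FeketeSOSDepthZeroShadow
import Summits.ValiantsHypothesis.ValiantsHypothesis.Theorems.FeketeSOSSublinearShadowTwoDeepShadow
import Summits.ValiantsHypothesis.ValiantsHypothesis.Theorems.FeketeSOSSublinearShadowQfSquares
import Summits.ValiantsHypothesis.ValiantsHypothesis.Theorems.FeketeSOSSublinearShadowMaxMinorFactor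

/-!
# `FeketeSOS.SublinearShadow` (stmt-ValiantsHypothesis-14990), line `Sketch`, reshape 5 — stub `stub_gramShadow`

**Gram-integral representations have shadows.**  Let `Σ_{i<s} c_i g_i² = F_p` over `ℂ` (`p` odd) and let `O ⊂ ℂ` be a
valuation subring with `p ∈ 𝔪_O` such that every entry `Q_{ab} = Σ_i c_i g_{i,a} g_{i,b}` of the GRAM MATRIX of the
representation lies in `O`.  Apply the maximal-minor factorisation (`stub_maxMinorFactor`) to the coefficient matrix
`V_{b,i} = g_{i,b}` (`b ∈ U = ∪ supp g_i`): `g_i = Σ_{j<r} g_{i,a_j} h_j` with `r ≤ s`, `h_j ∈ O[X]` supported on `U` and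
`h_{j, a_{j'}} = δ_{jj'}`.  Then `Σ c_i g_i² = Σ_{j,j'} B_{jj'} h_j h_{j'}` with `B_{jj'} = Σ_i c_i g_{i,a_j} g_{i,a_{j'}} = Q_{a_j a_{j'}}
∈ O`: an `O`-INTEGRAL quadratic form in `O`-integral polynomials.  Reduce modulo `𝔪_O` (residue field `K` of
characteristic `p`, `2 ≠ 0`), expand into `2r²` weighted squares `h̄_j ± h̄_{j'}` (`stub_qfSquares`), and fold exponents
modulo `p`: a cyclic characteristic-`p` shadow with `≤ 2s²` squares of degree `< p` and total support `≤ 2s² · S`.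
Term-wise integrality (`depthZeroShadow_proof`) and the two-deep case (`stub_twoDeepShadow`) are special cases.
-/

namespace Summit.ValiantsHypothesis.ValiantsHypothesis.Theorems.SublinearShadowSketch

open Polynomial Finset IsLocalRing Matrix
open scoped BigOperators
open Literature.NumberTheory.LFunctions
open Literature.RingTheory.Valuation

-- `Summit.ValiantsHypothesis.ValiantsHypothesis.…` is the tree's mandated single-conjunct layout (Sub = Summit).
set_option linter.dupNamespace false

/-- `2 ≠ 0` in the residue field of a valuation subring `O ⊂ ℂ` whose maximal ideal contains an odd prime. -/
theorem gsh_two_ne_zero_residue (O : ValuationSubring ℂ) {p : ℕ} (hp : p.Prime) (hp2 : p ≠ 2)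
    (hpO : ((p : ℕ) : O) ∈ maximalIdeal O) : (2 : ResidueField O) ≠ 0 := by
  have h2 : (2 : ℂ)⁻¹ ∈ O := tds_inv_two_mem O hp hp2 hpO
  have hunit : IsUnit (2 : O) := by
    refine isUnit_iff_exists_inv.mpr ⟨⟨(2 : ℂ)⁻¹, h2⟩, Subtype.ext ?_⟩
    push_cast
    exact mul_inv_cancel₀ two_ne_zero
  have h := (hunit.map (residue O)).ne_zero
  rwa [map_ofNat] at h

/-- The polynomial with coefficient vector a column of a matrix indexed by a finite set `U` of exponents:
its coefficients are the matrix entries on `U` and `0` off `U`. -/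
theorem gsh_coeff_colPoly {U : Finset ℕ} {r : ℕ} (H : Matrix U (Fin r) ℂ) (j : Fin r) (n : ℕ) :
    (∑ b : U, C (H b j) * X ^ (b : ℕ)).coeff n = if hn : n ∈ U then H ⟨n, hn⟩ j else 0 := by
  classical
  rw [finsetSum_coeff]
  simp only [coeff_C_mul_X_pow]
  by_cases hn : n ∈ U
  · rw [dif_pos hn, Finset.sum_eq_single ⟨n, hn⟩]
    · simp
    · intro b _ hb
      rw [if_neg]
      intro h
      exact hb (Subtype.ext h.symm)
    · intro h; exact absurd (Finset.mem_univ _) h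
  · rw [dif_neg hn]
    refine Finset.sum_eq_zero fun b _ => ?_
    rw [if_neg]
    intro h
    exact hn (h ▸ b.2)

/-- **Integral quadratic-form model of a representation** (maximal-minor normal form).  For any valuation subring
`O ⊂ ℂ` and any `c, g`: there are `r ≤ s` polynomials `h_j` with coefficients in `O`, supported on `U = ∪ supp g_i`, and
exponents `a_j` with `h_{j, a_{j'}} = δ_{jj'}`, such that `g_i = Σ_j g_{i,a_j} h_j` and
`Σ c_i g_i² = Σ_{j,j'} Q_{a_j a_{j'}} h_j h_{j'}` with the GRAM ENTRIES `Q_{ab} = Σ_i c_i g_{i,a} g_{i,b}` as coefficients. -/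
theorem gsh_qf_model (O : ValuationSubring ℂ) (s : ℕ) (c : Fin s → ℂ) (g : Fin s → ℂ[X]) :
    ∃ (r : ℕ) (a : Fin r → ℕ) (h : Fin r → ℂ[X]), r ≤ s ∧
      (∀ j n, (h j).coeff n ∈ O) ∧
      (∀ j, (h j).support ⊆ Finset.univ.biUnion fun i => (g i).support) ∧
      (∀ j j', (h j).coeff (a j') = if j = j' then 1 else 0) ∧
      (∀ i, g i = ∑ j, C ((g i).coeff (a j)) * h j) ∧
      (∑ i, C (c i) * g i ^ 2)
        = ∑ j, ∑ j', C (∑ i, c i * (g i).coeff (a j) * (g i).coeff (a j')) * (h j * h j') := by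
  classical
  -- the union of the supports and the coefficient matrix
  set U : Finset ℕ := Finset.univ.biUnion fun i => (g i).support with hU
  have hsuppU : ∀ i, (g i).support ⊆ U := fun i =>
    Finset.subset_biUnion_of_mem (fun i => (g i).support) (Finset.mem_univ i)
  set V : Matrix U (Fin s) ℂ := fun b i => (g i).coeff b with hV
  -- (1) maximal-minor factorisation
  obtain ⟨r, a, H, hr, hHint, hHδ, hVH⟩ := stub_maxMinorFactor O s V
  set h : Fin r → ℂ[X] := fun j => ∑ b : U, C (H b j) * X ^ (b : ℕ) with hh
  have hcoef_h : ∀ j n, (h j).coeff n = if hn : n ∈ U then H ⟨n, hn⟩ j else 0 := fun j n =>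
    gsh_coeff_colPoly H j n
  have hhint : ∀ j n, (h j).coeff n ∈ O := fun j n => by
    rw [hcoef_h]
    split_ifs with hn
    · exact hHint _ _
    · exact zero_mem O
  have hhsupp : ∀ j, (h j).support ⊆ U := fun j n hn => by
    rw [mem_support_iff, hcoef_h] at hn
    by_contra hnU
    exact hn (dif_neg hnU)
  have hδ : ∀ j j', (h j).coeff ((a j' : U) : ℕ) = if j = j' then 1 else 0 := fun j j' => by
    rw [hcoef_h, dif_pos (a j').2]
    exact hHδ j j'
  -- (2) every `g i` is a combination of the `h j` with coefficients `g_{i, a_j}`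
  have hg_expand : ∀ i, g i = ∑ j, C ((g i).coeff (a j)) * h j := fun i => by
    ext n
    rw [finsetSum_coeff]
    simp only [coeff_C_mul, hcoef_h]
    by_cases hn : n ∈ U
    · simp only [dif_pos hn]
      have e := congrArg (fun M : Matrix U (Fin s) ℂ => M ⟨n, hn⟩ i) hVH
      simp only [Matrix.mul_apply, Matrix.submatrix_apply, _root_.id] at e
      change (g i).coeff n = ∑ j, H ⟨n, hn⟩ j * (g i).coeff (a j) at e
      rw [e]
      exact Finset.sum_congr rfl fun j _ => mul_comm _ _
    · simp only [dif_neg hn, mul_zero, Finset.sum_const_zero]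
      exact notMem_support_iff.mp fun hmem => hn (hsuppU i hmem)
  -- (3) the representation as a quadratic form in the `h j` with Gram entries as coefficients
  have hqf : (∑ i, C (c i) * g i ^ 2)
      = ∑ j, ∑ j', C (∑ i, c i * (g i).coeff (a j) * (g i).coeff (a j')) * (h j * h j') := by
    have step1 : ∀ i, C (c i) * g i ^ 2
        = ∑ j, ∑ j', C (c i * (g i).coeff (a j) * (g i).coeff (a j')) * (h j * h j') := fun i => by
      conv_lhs => rw [hg_expand i]
      rw [sq, Finset.sum_mul_sum, Finset.mul_sum]
      refine Finset.sum_congr rfl fun j _ => ?_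
      rw [Finset.mul_sum]
      refine Finset.sum_congr rfl fun j' _ => ?_
      simp only [C_mul]
      ring
    rw [Finset.sum_congr rfl fun i _ => step1 i, Finset.sum_comm]
    refine Finset.sum_congr rfl fun j _ => ?_
    rw [Finset.sum_comm]
    refine Finset.sum_congr rfl fun j' _ => ?_
    rw [← Finset.sum_mul, ← map_sum]
  exact ⟨r, fun j => ((a j : U) : ℕ), h, hr, hhint, hhsupp, hδ, hg_expand, hqf⟩

/-- **`stub_gramShadow` (registered stub of line `Sketch`, reshape 5).**  If `Σ_{i<s} c_i g_i² = F_p` over `ℂ`, `p` odd,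
and at some valuation subring `O ⊂ ℂ` with `p ∈ 𝔪_O` every Gram entry `Σ_i c_i g_{i,a} g_{i,b}` lies in `O`, then `F̄_p` has
a cyclic characteristic-`p` shadow with `≤ 2s²` weighted squares of degree `< p` and total support `≤ 2s² · S`. -/
theorem stub_gramShadow (p : ℕ) [Fact p.Prime] (hp2 : p ≠ 2) (s : ℕ) (c : Fin s → ℂ) (g : Fin s → ℂ[X])
    (hrep : (∑ i, C (c i) * g i ^ 2) = ∑ m ∈ Finset.range p, C ((legendreSym p m : ℤ) : ℂ) * X ^ m)
    (O : ValuationSubring ℂ) (hpO : ((p : ℕ) : O) ∈ maximalIdeal O)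
    (hgram : ∀ a b : ℕ, (∑ i, c i * (g i).coeff a * (g i).coeff b) ∈ O) :
    ∃ (K : Type) (_ : Field K) (_ : CharP K p) (d : ℕ) (c' : Fin d → K) (g' : Fin d → Polynomial K),
      d ≤ 2 * (s * s) ∧ (∀ j, (g' j).natDegree < p) ∧
      (∑ j, (g' j).support.card) ≤ 2 * (s * s) * ∑ i, (g i).support.card ∧
      ((X : Polynomial K) ^ p - 1 ∣ (∑ j, C (c' j) * g' j ^ 2)
        - ∑ m ∈ Finset.range p, C ((legendreSym p m : ℤ) : K) * X ^ m) := by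
  classical
  have hprime : p.Prime := Fact.out
  have hp0 : 0 < p := hprime.pos
  haveI hchar : CharP (ResidueField O) p := charP_residueField O hpO
  set ι : O →+* ℂ := algebraMap O ℂ with hι
  have hιinj : Function.Injective ι := IsFractionRing.injective O ℂ
  set ρ : O →+* ResidueField O := residue O with hρ
  set U : Finset ℕ := Finset.univ.biUnion fun i => (g i).support with hU
  have hUcard : U.card ≤ ∑ i, (g i).support.card := Finset.card_biUnion_le
  -- (1)–(3) the integral quadratic-form model
  obtain ⟨r, a, h, hr, hhint, hhsupp, _hδ, _hg_expand, hqf⟩ := gsh_qf_model O s c g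
  set B : Fin r → Fin r → ℂ := fun j j' => ∑ i, c i * (g i).coeff (a j) * (g i).coeff (a j') with hB
  have hBint : ∀ j j', B j j' ∈ O := fun j j' => hgram (a j) (a j')
  -- (4) lift to `O[X]` and push to the residue field
  choose Hh hHh hHhsupp using fun j => dzs_exists_lift O (hhint j)
  set BO : Fin r → Fin r → O := fun j j' => ⟨B j j', hBint j j'⟩ with hBO
  have hFmap : ∀ (R S : Type) [CommRing R] [CommRing S] (f : R →+* S),
      ((feketePolynomial p).map (Int.castRingHom R)).map f
        = (feketePolynomial p).map (Int.castRingHom S) := fun R S _ _ f => by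
    rw [Polynomial.map_map, RingHom.ext_int (f.comp (Int.castRingHom R)) (Int.castRingHom S)]
  have hFK : (feketePolynomial p).map (Int.castRingHom (ResidueField O)) =
      ∑ m ∈ Finset.range p, C ((legendreSym p m : ℤ) : ResidueField O) * X ^ m := by
    simp only [map_feketePolynomial, eq_intCast]
  have hrepO : (∑ j, ∑ j', C (BO j j') * (Hh j * Hh j')) = (feketePolynomial p).map (Int.castRingHom O) := by
    apply Polynomial.map_injective ι hιinj
    rw [hFmap O ℂ ι, map_feketePolynomial_complex, ← hrep, hqf, Polynomial.map_sum]
    refine Finset.sum_congr rfl fun j _ => ?_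
    rw [Polynomial.map_sum]
    refine Finset.sum_congr rfl fun j' _ => ?_
    rw [Polynomial.map_mul, Polynomial.map_mul, map_C, hHh, hHh]
    rfl
  set Bk : Fin r → Fin r → ResidueField O := fun j j' => ρ (BO j j') with hBk
  set hk : Fin r → (ResidueField O)[X] := fun j => (Hh j).map ρ with hhk
  have hrepK : (∑ j, ∑ j', C (Bk j j') * (hk j * hk j')) =
      (feketePolynomial p).map (Int.castRingHom (ResidueField O)) := by
    rw [← hFmap O (ResidueField O) ρ, ← hrepO, Polynomial.map_sum]
    refine Finset.sum_congr rfl fun j _ => ?_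
    rw [Polynomial.map_sum]
    refine Finset.sum_congr rfl fun j' _ => ?_
    rw [Polynomial.map_mul, Polynomial.map_mul, map_C]
  have hhksupp : ∀ j, (hk j).support ⊆ U := fun j =>
    (support_map_subset _ _).trans (by rw [hHhsupp j]; exact hhsupp j)
  -- (5) expand into `2r²` weighted squares over the residue field
  have h2k : (2 : ResidueField O) ≠ 0 := gsh_two_ne_zero_residue O hprime hp2 hpO
  obtain ⟨c', g', hsq, hsqsupp⟩ := stub_qfSquares (ResidueField O) h2k r Bk hk
  have hg'supp : ∀ k, (g' k).support ⊆ U := fun k => by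
    obtain ⟨j, j', hk⟩ := hsqsupp k
    exact hk.trans (Finset.union_subset (hhksupp j) (hhksupp j'))
  -- (6) fold cyclically and assemble
  obtain ⟨g'', hg''⟩ : ∃ g'' : Fin (2 * (r * r)) → (ResidueField O)[X],
      ∀ k, g'' k = ∑ n ∈ (g' k).support, C ((g' k).coeff n) * X ^ (n % p) := ⟨_, fun _ => rfl⟩
  have hg''deg : ∀ k, (g'' k).natDegree < p := fun k => by
    rw [hg'' k]; exact dzs_natDegree_fold_lt (g' k) hp0
  have hg''supp : ∀ k, (g'' k).support.card ≤ U.card := fun k => by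
    rw [hg'' k]
    exact (dzs_card_support_fold_le (g' k) p).trans (Finset.card_le_card (hg'supp k))
  have hg''dvd : ∀ k, (X : (ResidueField O)[X]) ^ p - 1 ∣ g'' k - g' k := fun k => by
    rw [hg'' k]; exact dzs_X_pow_sub_one_dvd_fold_sub (g' k) p
  have hfin : (X : (ResidueField O)[X]) ^ p - 1 ∣
      (∑ k, C (c' k) * g'' k ^ 2) - ∑ m ∈ Finset.range p, C ((legendreSym p m : ℤ) : ResidueField O) * X ^ m := by
    have h := dzs_dvd_sum_sq_sub c' g' g'' _ (hsq.trans hrepK) hg''dvd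
    rw [hFK] at h
    exact h
  refine ⟨ResidueField O, inferInstance, hchar, 2 * (r * r), c', g'', ?_, hg''deg, ?_, hfin⟩
  · exact Nat.mul_le_mul_left 2 (Nat.mul_le_mul hr hr)
  · calc (∑ k, (g'' k).support.card) ≤ ∑ _k : Fin (2 * (r * r)), U.card := Finset.sum_le_sum fun k _ => hg''supp k
      _ = 2 * (r * r) * U.card := by simp
      _ ≤ 2 * (s * s) * ∑ i, (g i).support.card :=
          Nat.mul_le_mul (Nat.mul_le_mul_left 2 (Nat.mul_le_mul hr hr)) hUcard

end Summit.ValiantsHypothesis.ValiantsHypothesis.Theorems.SublinearShadowSketch
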